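import Mathlib
import Literature.Geometry.DiscreteGeometry.DelaunaySubdivision
import Summits.AtomisticToContinuum.Crystallization.Theorems.SquareWellLayerCakeAveragedTwelveLensPin
import Summits.AtomisticToContinuum.Crystallization.Theorems.SquareWellLayerCakeAveragedTwelveEdgeValence
import Summits.AtomisticToContinuum.Crystallization.Theorems.SquareWellLayerCakeAveragedTwelveTwoCells
import HarnessLib

/-!
# Crux `SquareWellLayerCake.AveragedTwelve` (stmt-AtomisticToContinuum-15806), line `Sketch`
# (idea par-five-delaunay-recount), stub `stub_sixValentShort` — six-valent all-near edges are short

SIX-VALENT ALL-NEAR EDGES ARE SHORT.  Let `K` triangulate the finite `d`-separated site set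
`ω ⊂ ℝ³` (`Literature.Geometry.DiscreteGeometry.IsTriangulation`), let `{v, z}` be an edge of `K`
with `v ∈ ω` interior to `conv ω`, and let `S` be the set of cells (simplices with `4` vertices) of
`K` containing `v` and `z`.  If every cell of `S` has all its pairwise vertex distances
`≤ (57/50) d` and `#S ≥ 6`, then `|vz| < (113/100) d`.

**Proof** (finset bookkeeping on top of three landed stubs of the line).
1. Let `T` be the set of triangles (simplices with `3` vertices) of `K` containing `v` and `z`.
   By the landed edge-valence identity `ParFiveRecountEdgeValence.stub_edgeValence`, `#S = #T`,
   so `#T ≥ 6`.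
2. Every `σ ∈ T` lies in a cell of `S`: by the landed `ParFiveRecountTwoCells.stub_twoCellsPerFace`
   (`v ∈ σ` is interior) exactly two cells of `K` contain `σ`, in particular one, and a cell through
   `σ ∋ v, z` belongs to `S`.  Hence the third vertex `x` of `σ = {v, z, x}` satisfies
   `|xv|, |xz| ≤ (57/50) d`; also `|vz| ≤ (57/50) d` (`S ≠ ∅`).
3. The third vertices form a finset `X` with `#T ≤ #X` (`σ ↦ x` is injective since
   `σ = {x, v, z}`, `card_le_card_link`); they are vertices of `K`, hence sites
   (`IsTriangulation.mem_of_mem`), pairwise `d`-separated and at distance `≥ d` from the sites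
   `v ≠ x` and `z ≠ x`.
4. If `(113/100) d ≤ |vz|`, the landed lens pinning `ParFiveRecountLensPin.stub_lensPinning`
   (with `ρ := (57/50) d`, the pair `v, z` and the finset `X`) gives `#X ≤ 5 < 6 ≤ #T ≤ #X`,
   a contradiction.
-/

noncomputable section

open scoped BigOperators Classical

namespace Summit.AtomisticToContinuum.Crystallization.Theorems.ParFiveRecountSixValentShort

open Literature.Geometry.DiscreteGeometry
open Summit.AtomisticToContinuum.Crystallization.Theorems

/-- **A triangle is its edge plus its third vertex.**  If `σ` has `3` elements, among them `v`
and `z ≠ v`, and `x ∈ σ ∖ {v, z}`, then `σ = {x, v, z}`. [folklore] -/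
theorem insert_eq_of_card_three {α : Type*} [DecidableEq α] {σ : Finset α} {v z x : α}
    (hzv : z ≠ v) (hσ3 : σ.card = 3) (hvσ : v ∈ σ) (hzσ : z ∈ σ)
    (hx : x ∈ (σ.erase v).erase z) : insert x ({v, z} : Finset α) = σ := by
  rw [Finset.mem_erase, Finset.mem_erase] at hx
  obtain ⟨hxz, hxv, hxσ⟩ := hx
  refine Finset.eq_of_subset_of_card_le
    (Finset.insert_subset hxσ (Finset.insert_subset hvσ (Finset.singleton_subset_iff.2 hzσ))) ?_
  rw [hσ3, Finset.card_insert_of_notMem (by simp [hxz, hxv]), Finset.card_pair hzv.symm]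

/-- **The link of an edge has as many vertices as triangles.**  If every member of a finset `T`
of `3`-element sets contains `v` and `z ≠ v`, then the set of third vertices
`⋃_{σ ∈ T} (σ ∖ {v, z})` has at least `#T` elements: `T` is contained in its image under
`x ↦ {x, v, z}` (`insert_eq_of_card_three`). [folklore] -/
theorem card_le_card_link {α : Type*} [DecidableEq α] {v z : α} (hzv : z ≠ v)
    (T : Finset (Finset α)) (hT : ∀ σ ∈ T, v ∈ σ ∧ z ∈ σ ∧ σ.card = 3) :
    T.card ≤ (T.biUnion fun σ => (σ.erase v).erase z).card := by
  calc T.card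
      ≤ ((T.biUnion fun σ => (σ.erase v).erase z).image
          fun x => insert x ({v, z} : Finset α)).card := by
        refine Finset.card_le_card fun σ hσ => ?_
        obtain ⟨hvσ, hzσ, hσ3⟩ := hT σ hσ
        have h1 : ((σ.erase v).erase z).card = 1 := by
          rw [Finset.card_erase_of_mem (Finset.mem_erase.2 ⟨hzv, hzσ⟩),
            Finset.card_erase_of_mem hvσ, hσ3]
        obtain ⟨x, hx⟩ := Finset.card_eq_one.1 h1
        have hxσ : x ∈ (σ.erase v).erase z := hx ▸ Finset.mem_singleton_self x
        exact Finset.mem_image.2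
          ⟨x, Finset.mem_biUnion.2 ⟨σ, hσ, hxσ⟩, insert_eq_of_card_three hzv hσ3 hvσ hzσ hxσ⟩
    _ ≤ (T.biUnion fun σ => (σ.erase v).erase z).card := Finset.card_image_le

/-- **Six-valent all-near edges are short** (registered stub `stub_sixValentShort` of line
`Sketch`, crux `SquareWellLayerCake.AveragedTwelve`).  In a triangulation `K` of a finite
`d`-separated `ω ⊂ ℝ³`, an edge `vz` with `v ∈ ω` interior to `conv ω`, at least six cells on it,
and all of whose cells have their pairwise vertex distances `≤ (57/50) d`, has length
`< (113/100) d`: the cells on `vz` are as many as the triangles on `vz`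
(`ParFiveRecountEdgeValence.stub_edgeValence`), each triangle `{v, z, x}` lies in a cell on `vz`
(`ParFiveRecountTwoCells.stub_twoCellsPerFace`), so the `≥ 6` third vertices `x` are pairwise
`d`-separated sites within `[d, (57/50) d]` of both `v` and `z`, and if `(113/100) d ≤ |vz|` the
lens pinning `ParFiveRecountLensPin.stub_lensPinning` allows at most five of them. [folklore] -/
theorem stub_sixValentShort : ∀ (d : ℝ), 0 < d → ∀ (ω : Finset (EuclideanSpace ℝ (Fin 3))) (K : Geometry.SimplicialComplex ℝ (EuclideanSpace ℝ (Fin 3))), Literature.Geometry.DiscreteGeometry.IsTriangulation (↑ω : Set (EuclideanSpace ℝ (Fin 3))) K → (∀ a ∈ ω, ∀ b ∈ ω, a ≠ b → d ≤ dist a b) → ∀ v ∈ ω, v ∈ interior (convexHull ℝ (↑ω : Set (EuclideanSpace ℝ (Fin 3)))) → ∀ (z : EuclideanSpace ℝ (Fin 3)), z ≠ v → ({v, z} : Finset (EuclideanSpace ℝ (Fin 3))) ∈ K.faces → ∀ (S : Finset (Finset (EuclideanSpace ℝ (Fin 3)))), (∀ t, t ∈ S ↔ t ∈ K.faces ∧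 v ∈ t ∧ z ∈ t ∧ t.card = 4) → (∀ t ∈ S, ∀ a ∈ t, ∀ b ∈ t, dist a b ≤ 57 / 50 * d) → 6 ≤ S.card → dist v z < 113 / 100 * d := by
  classical
  intro d hd ω K hK hsep v hvω hvint z hzv hvz S hS hnear h6
  have hfin : K.faces.Finite := hK.finite_faces ω.finite_toSet
  -- (1) the triangles on the edge: as many as the cells on the edge
  set T : Finset (Finset (EuclideanSpace ℝ (Fin 3))) :=
    hfin.toFinset.filter fun σ => v ∈ σ ∧ z ∈ σ ∧ σ.card = 3 with hTdef
  have hT : ∀ σ, σ ∈ T ↔ σ ∈ K.faces ∧ v ∈ σ ∧ z ∈ σ ∧ σ.card = 3 := by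
    intro σ; simp only [hTdef, Finset.mem_filter, Set.Finite.mem_toFinset]
  have hST : S.card = T.card :=
    ParFiveRecountEdgeValence.stub_edgeValence ω K hK v hvω hvint z hzv hvz S T hS hT
  -- (2) each triangle on the edge lies in a cell on the edge
  have hcell : ∀ σ ∈ T, ∃ t ∈ S, σ ⊆ t := by
    intro σ hσ
    obtain ⟨hσK, hvσ, hzσ, hσ3⟩ := (hT σ).1 hσ
    set C : Finset (Finset (EuclideanSpace ℝ (Fin 3))) :=
      hfin.toFinset.filter fun t => t.card = 4 ∧ σ ⊆ t with hCdef
    have hC : ∀ t, t ∈ C ↔ t ∈ K.faces ∧ t.card = 4 ∧ σ ⊆ t := by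
      intro t; simp only [hCdef, Finset.mem_filter, Set.Finite.mem_toFinset]
    have hC2 : C.card = 2 :=
      ParFiveRecountTwoCells.stub_twoCellsPerFace ω K hK σ hσK hσ3 ⟨v, hvσ, hvint⟩ C hC
    obtain ⟨t, ht⟩ := Finset.card_pos.1 (by omega : 0 < C.card)
    obtain ⟨htK, ht4, hσt⟩ := (hC t).1 ht
    exact ⟨t, (hS t).2 ⟨htK, hσt hvσ, hσt hzσ, ht4⟩, hσt⟩
  -- (3) the third vertices of the triangles on the edge
  set X : Finset (EuclideanSpace ℝ (Fin 3)) := T.biUnion fun σ => (σ.erase v).erase z with hXdef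
  have hX : ∀ x ∈ X, ∃ σ ∈ T, x ≠ z ∧ x ≠ v ∧ x ∈ σ := by
    intro x hx
    obtain ⟨σ, hσ, hxσ⟩ := Finset.mem_biUnion.1 hx
    rw [Finset.mem_erase, Finset.mem_erase] at hxσ
    exact ⟨σ, hσ, hxσ.1, hxσ.2.1, hxσ.2.2⟩
  have h6X : 6 ≤ X.card := by
    have hTX : T.card ≤ X.card := card_le_card_link hzv T fun σ hσ => ((hT σ).1 hσ).2
    omega
  have hXω : ∀ x ∈ X, x ∈ ω := by
    intro x hx
    obtain ⟨σ, hσ, -, -, hxσ⟩ := hX x hx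
    exact Finset.mem_coe.1 (hK.mem_of_mem ((hT σ).1 hσ).1 hxσ)
  have hzω : z ∈ ω := Finset.mem_coe.1 (hK.mem_of_mem hvz (by simp))
  -- the edge itself is near (`S` is nonempty)
  have hvz' : dist v z ≤ 57 / 50 * d := by
    obtain ⟨t₀, ht₀⟩ := Finset.card_pos.1 (by omega : 0 < S.card)
    obtain ⟨-, hvt, hzt, -⟩ := (hS t₀).1 ht₀
    exact hnear t₀ ht₀ v hvt z hzt
  -- (4) a long edge would have at most five points in its lens
  by_contra hlt
  have hle : 113 / 100 * d ≤ dist v z := le_of_not_gt hlt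
  have h5 : X.card ≤ 5 := by
    refine ParFiveRecountLensPin.stub_lensPinning d (57 / 50 * d) hd le_rfl v z hle hvz' X ?_ ?_
    · intro x hx
      obtain ⟨σ, hσ, hxz, hxv, hxσ⟩ := hX x hx
      obtain ⟨-, hvσ, hzσ, -⟩ := (hT σ).1 hσ
      have hxω : x ∈ ω := hXω x hx
      obtain ⟨t, ht, hσt⟩ := hcell σ hσ
      exact ⟨hsep x hxω v hvω hxv, hnear t ht x (hσt hxσ) v (hσt hvσ),
        hsep x hxω z hzω hxz, hnear t ht x (hσt hxσ) z (hσt hzσ)⟩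
    · intro x hx w hw hxw
      exact hsep x (hXω x hx) w (hXω w hw) hxw
  omega

end Summit.AtomisticToContinuum.Crystallization.Theorems.ParFiveRecountSixValentShort

end
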